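import Literature.AnabelianGeometry.SemiGraphs.TemperedReconstructionR2bHomProofsAt
import Literature.AnabelianGeometry.SemiGraphs.TemperedThm37OfCompactInVerticialAt
import Literature.AnabelianGeometry.SemiGraphs.TemperedQuasiGeometricCompatible
import HarnessLib

/-!
# [SemiAnbd] Cor. 3.9, step (b): the residual (R2′) AT ONE PAIR OF GRAPHS — from Thm 3.7 (iii) at `𝒢`
# and at `ℋ` alone (φ2 twin of `TemperedReconstructionR2bCompatProofs`, proof-only)

Mochizuki, *Semi-graphs of anabelioids*, Publ. RIMS **42** (2006) [MochizukiSemiAnbd2006], Cor. 3.9,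
proof, PRIMS pp. 267–268 (kurims pp. 42–43) [cite: MochizukiSemiAnbd2006, Cor 3.9 pp.42-43].

PROOF-ONLY companion (cell abc-iut, layer L3, L3-lead rulings α4-3 (iii) / α6-1 «φ2-CONSUMERS», block
B6, seat abc-iut-w4-d083 = author of the original) of `TemperedReconstructionR2bCompatProofs.lean`: the
two closers there conclude the ∀-graph named residual `QuasiGeometricGraphDataCompat` (abc-iut-L3-t2,
`TemperedReconstructionCompat.lean`) from the ∀-countable Thm 3.7 facts; here the BODY of that
residual AT the pair `(𝒢, ℋ)` — for `G`, `H` as in Cor. 3.9 and a compatibly quasi-geometric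
`φ : π₁^temp(G) → π₁^temp(H)` there is a locally open morphism of semi-graphs of anabelioids `G → H`
compatible with `φ` on verticial and edge homomorphisms — is concluded from abc-iut-w4-d075's per-graph
predicates (`TemperedCompactInVerticialAt.lean`): Thm 3.7 (iii) at `ℋ`, Thm 3.7 (iv) at `𝒢` and at `ℋ`,
`EdgeLikeDistinct` at `ℋ` (`quasiGeometricGraphDataCompatAt_of_thm37`, via block B4
`exists_hom_of_isQuasiGeometric_of_compatAt`), hence — binding the landed `verticialInjective_holds`,
`verticialDistinct_holds` and abc-iut-w4-d075's per-graph reductions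
`maximalCompactIffVerticialAt_of_compactInVerticialAt` / `edgeLikeDistinctAt_of_compactInVerticialAt` —
from Thm 3.7 (iii) AT `𝒢` AND AT `ℋ` ALONE (`quasiGeometricGraphDataCompatAt_of_compactInVerticialAt`),
and so at every pair of FINITE graphs from the finite-`𝔾` producer statement
(`quasiGeometricGraphDataCompatAt_of_finite`, print p. 41 «since the semi-graphs `𝔾_j` are all
finite»).  No definition, no restatement of the residual (the conclusion is its body, unfolded); original
untouched.  The literal `QuasiGeometricGraphData` stays OPEN AS TYPED (false for "folds": findings
W4d083-F1 / t2g2-F1).  Nothing here asserts Thm 3.7 (iii) for a countable `𝔾`; nothing here takes a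
side on [IUTchIII] Cor. 3.12; typed ≠ discharged.
-/

namespace Literature.AnabelianGeometry.SemiGraphs

namespace ProfiniteSemiGraph

universe u w

variable {𝒢 ℋ : ProfiniteSemiGraph.{u}}

/-- **(R2′) AT the pair `(𝒢, ℋ)` from Theorem 3.7 (i), (ii), (iii) at `ℋ`, (iv) at `𝒢` and at `ℋ`, and
`EdgeLikeDistinct` at `ℋ`** (φ2 twin of `quasiGeometricGraphDataCompat_of_thm37`): a compatibly
quasi-geometric `φ` admits a locally open morphism of semi-graphs of anabelioids `G → H` compatible with
it on verticial and edge homomorphisms ([SemiAnbd] Cor. 3.9, proof, pp. 267–268) — the body of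
`QuasiGeometricGraphDataCompat` at `(𝒢, ℋ)`. [cite: MochizukiSemiAnbd2006, Cor 3.9 pp.42-43] -/
theorem quasiGeometricGraphDataCompatAt_of_thm37 (h37i : VerticialInjective.{u})
    (h37ii : VerticialDistinct.{u}) (hℋiii : CompactInVerticialAt ℋ)
    (h37iv𝒢 : MaximalCompactIffVerticialAt 𝒢) (h37ivℋ : MaximalCompactIffVerticialAt ℋ)
    (hED : EdgeLikeDistinctAt ℋ) (h𝒢 : Cor39Hypotheses 𝒢) (hℋ : Cor39Hypotheses ℋ)
    (c𝒢 : TemperedPiChart 𝒢) (cℋ : TemperedPiChart ℋ) (φ : c𝒢.G →ₜ* cℋ.G)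
    (hφ : IsCompatiblyQuasiGeometric φ) :
    ∃ F : Hom 𝒢 ℋ, F.IsLocallyOpen ∧ F.CompatV c𝒢 cℋ φ ∧ F.CompatE c𝒢 cℋ φ :=
  exists_hom_of_isQuasiGeometric_of_compatAt h37i h37ii hℋiii h37iv𝒢 h37ivℋ hED h𝒢 hℋ c𝒢 cℋ φ
    hφ.isQuasiGeometric hφ.compat

/-- **(R2′) AT the pair `(𝒢, ℋ)` from Theorem 3.7 (iii) AT `𝒢` AND AT `ℋ` alone** (φ2 twin of
`quasiGeometricGraphDataCompat_of_compactInVerticial`; (i), (ii) are discharged in the tree, (iv) at a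
graph and `EdgeLikeDistinct` at a graph reduce to (iii) at that graph by abc-iut-w4-d075's per-graph
reductions). [cite: MochizukiSemiAnbd2006, Cor 3.9 pp.42-43] -/
theorem quasiGeometricGraphDataCompatAt_of_compactInVerticialAt (h𝒢iii : CompactInVerticialAt 𝒢)
    (hℋiii : CompactInVerticialAt ℋ) (h𝒢 : Cor39Hypotheses 𝒢) (hℋ : Cor39Hypotheses ℋ)
    (c𝒢 : TemperedPiChart 𝒢) (cℋ : TemperedPiChart ℋ) (φ : c𝒢.G →ₜ* cℋ.G)
    (hφ : IsCompatiblyQuasiGeometric φ) :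
    ∃ F : Hom 𝒢 ℋ, F.IsLocallyOpen ∧ F.CompatV c𝒢 cℋ φ ∧ F.CompatE c𝒢 cℋ φ :=
  quasiGeometricGraphDataCompatAt_of_thm37 verticialInjective_holds verticialDistinct_holds hℋiii
    (maximalCompactIffVerticialAt_of_compactInVerticialAt h𝒢iii)
    (maximalCompactIffVerticialAt_of_compactInVerticialAt hℋiii)
    (edgeLikeDistinctAt_of_compactInVerticialAt hℋiii) h𝒢 hℋ c𝒢 cℋ φ hφ

/-- **(R2′) at every pair of FINITE graphs, from the producer statement for finite `𝒢`** (print p. 41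
«since the semi-graphs `𝔾_j` are all finite»; φ2 finite twin of (R2′), via
`compactInVerticialAt_of_finite`). [cite: MochizukiSemiAnbd2006, Cor 3.9 pp.42-43] -/
theorem quasiGeometricGraphDataCompatAt_of_finite
    (hDfin : ∀ (𝒢 : ProfiniteSemiGraph.{u}), 𝒢.Thm37Hypotheses → Finite 𝒢.graph.Vertex →
      Finite 𝒢.graph.Edge → ∃ c₀ : TemperedPiChart 𝒢, Nonempty (FiniteLevelData.{w} 𝒢 c₀))
    (hV𝒢 : Finite 𝒢.graph.Vertex) (hE𝒢 : Finite 𝒢.graph.Edge) (hVℋ : Finite ℋ.graph.Vertex)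
    (hEℋ : Finite ℋ.graph.Edge) (h𝒢 : Cor39Hypotheses 𝒢) (hℋ : Cor39Hypotheses ℋ)
    (c𝒢 : TemperedPiChart 𝒢) (cℋ : TemperedPiChart ℋ) (φ : c𝒢.G →ₜ* cℋ.G)
    (hφ : IsCompatiblyQuasiGeometric φ) :
    ∃ F : Hom 𝒢 ℋ, F.IsLocallyOpen ∧ F.CompatV c𝒢 cℋ φ ∧ F.CompatE c𝒢 cℋ φ :=
  quasiGeometricGraphDataCompatAt_of_compactInVerticialAt (compactInVerticialAt_of_finite hDfin hV𝒢 hE𝒢)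
    (compactInVerticialAt_of_finite hDfin hVℋ hEℋ) h𝒢 hℋ c𝒢 cℋ φ hφ

end ProfiniteSemiGraph

end Literature.AnabelianGeometry.SemiGraphs
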